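import Literature.Computability.QuantumComplexity.SampleLoopCodeFP
import Literature.Computability.Complexity.LoopUntilFlag
import Literature.Computability.Complexity.TimeBoundsProofs
import HarnessLib
/-!
# Discharge of `BravyiGosset2016_estimateAcceptProb`: the machine and its running time

Topic `Literature/Computability/QuantumComplexity`, sub-namespace `BravyiGosset`; the last file of
the discharge. The randomized algorithm `randAlg = ⟨estimate, coinLen⟩`
(`BravyiGossetEstimator.lean`, guarantee `pr_goodEstimates_ge`) is run by the loop machine
`TM2Until.untilAux` (`LoopUntilFlag.lean`) of ONE polynomial-time round function `bgRoundFn`: round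
`0` attaches the initial loop state to the input, every later round performs one step `stepLS`
of the flattened sample/term loop (`SampleLoopCodeFP.lean`) or, once all `L = 16(q+1)²` samples
are banked, raises the flag with the output `encodeRat (estimate i r)`. There are
`L · 2^{⌈t/2⌉} + 2` rounds, each on a word of length polynomial in the input, whence the running
time `c (n + m + |circ| + q + 2)^k 2^{⌈t/2⌉}` of the named fact
(`BravyiGosset2016_estimateAcceptProb_holds`).

## References

* S. Bravyi, D. Gosset, *Improved classical simulation of quantum circuits dominated by Clifford
  gates*, Phys. Rev. Lett. 116 (2016) 250501, p. 2 eq. (2) and §II ("the cost `2^{0.5 t} t³ ε⁻²`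
  of the norm estimation dominates").
* S. Arora, B. Barak, *Computational Complexity: A Modern Approach*, CUP 2009, §1.3 (machines as
  subroutines; the running time of a loop is the sum over its rounds), §7.1.
-/

namespace Literature.Computability.QuantumComplexity.BravyiGosset

open _root_.Computability Literature.Computability.Complexity Literature.Computability.Complexity.CodeFP
  Literature.Computability.Cryptography Literature.Algebra.EuclideanLattices Finset Polynomial

/-! ### The round function -/

/-- The carried word: context and loop state. [folklore] -/
abbrev cwE : (IT × List Bool) × LS → List Bool := pairE lcE lsE

/-- Carrying the context along one step. [folklore] -/
theorem carry_codeFP : CodeFP cwE cwE (fun t => (t.1, stepLS t.1 t.2)) := (fst _ _).pair stepLS_codeFP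

/-- The step on strings. [folklore] -/
noncomputable def bgStepFn : List Bool → List Bool := Classical.choose carry_codeFP

/-- `bgStepFn ∈ FP`. [folklore] -/
theorem bgStepFn_mem_FP : bgStepFn ∈ FP := (Classical.choose_spec carry_codeFP).1

/-- `bgStepFn` on carried words. [folklore] -/
theorem bgStepFn_apply (c : IT × List Bool) (s : LS) : bgStepFn (cwE (c, s)) = cwE (c, stepLS c s) :=
  (Classical.choose_spec carry_codeFP).2 (c, s)

/-- The loop test on strings. [folklore] -/
noncomputable def bgCondFn : List Bool → List Bool := Classical.choose ltL_codeFP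

/-- `bgCondFn ∈ FP`. [folklore] -/
theorem bgCondFn_mem_FP : bgCondFn ∈ FP := (Classical.choose_spec ltL_codeFP).1

/-- `bgCondFn` on carried words. [folklore] -/
theorem bgCondFn_apply (c : IT × List Bool) (s : LS) : bgCondFn (cwE (c, s)) = [decide (s.1 < numSamples c.1.2.2)] :=
  (Classical.choose_spec ltL_codeFP).2 (c, s)

/-- The output on strings. [folklore] -/
noncomputable def bgOutFn : List Bool → List Bool := Classical.choose output_codeFP

/-- `bgOutFn ∈ FP`. [folklore] -/
theorem bgOutFn_mem_FP : bgOutFn ∈ FP := (Classical.choose_spec output_codeFP).1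

/-- `bgOutFn` on carried words. [folklore] -/
theorem bgOutFn_apply (c : IT × List Bool) (s : LS) :
    bgOutFn (cwE (c, s)) = ratE (finalize s.2.2.2.1 s.2.2.2.2 (denomT c.1) c.1.2.2) :=
  (Classical.choose_spec output_codeFP).2 (c, s)

/-- Round `0` on strings: attach the initial loop state. [folklore] -/
noncomputable def bgInitFn : List Bool → List Bool := List.cons false ∘ fanoutFn List.tail fun _ => lsE initLS

/-- **The round function** of the machine: on `0x` attach the initial state; on `1⟨x, s⟩` do one
step (flag `0`) or, when all samples are banked, output (flag `1`). [cite: AroraBarakCC2009, §1.3] -/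
noncomputable def bgRoundFn : List Bool → List Bool :=
  iteFn take1Fn (iteFn (bgCondFn ∘ List.tail) (List.cons false ∘ bgStepFn ∘ List.tail) (List.cons true ∘ bgOutFn ∘ List.tail)) bgInitFn

/-- **`bgRoundFn ∈ FP`.** [cite: AroraBarakCC2009, §1.3] -/
theorem bgRoundFn_mem_FP : bgRoundFn ∈ FP :=
  iteFn_mem_FP take1Fn_mem_FP
    (iteFn_mem_FP (comp_mem_FP bgCondFn_mem_FP PRelSigma.tail_mem_FP)
      (comp_mem_FP (cons_mem_FP false) (comp_mem_FP bgStepFn_mem_FP PRelSigma.tail_mem_FP))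
      (comp_mem_FP (cons_mem_FP true) (comp_mem_FP bgOutFn_mem_FP PRelSigma.tail_mem_FP)))
    (comp_mem_FP (cons_mem_FP false) (fanoutFn_mem_FP PRelSigma.tail_mem_FP (const_mem_FP _)))

/-- Round `0`. [folklore] -/
theorem bgRoundFn_false (x : List Bool) : bgRoundFn (false :: x) = false :: boolPair x (lsE initLS) := by
  rw [bgRoundFn, iteFn_apply_false (show take1Fn (false :: x) = [false] from rfl), bgInitFn, Function.comp_apply,
    fanoutFn_apply]
  rfl

/-- A continuing round. [folklore] -/
theorem bgRoundFn_true_cont (c : IT × List Bool) (s : LS) (h : s.1 < numSamples c.1.2.2) :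
    bgRoundFn (true :: cwE (c, s)) = false :: cwE (c, stepLS c s) := by
  rw [bgRoundFn, iteFn_apply_true (show take1Fn (true :: cwE (c, s)) = [true] from rfl),
    iteFn_apply_true (by rw [Function.comp_apply, List.tail_cons, bgCondFn_apply, decide_eq_true h])]
  show false :: bgStepFn ((true :: cwE (c, s)).tail) = _
  rw [List.tail_cons, bgStepFn_apply]

/-- The halting round. [folklore] -/
theorem bgRoundFn_true_halt (c : IT × List Bool) (s : LS) (h : ¬s.1 < numSamples c.1.2.2) :
    bgRoundFn (true :: cwE (c, s)) = true :: ratE (finalize s.2.2.2.1 s.2.2.2.2 (denomT c.1) c.1.2.2) := by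
  rw [bgRoundFn, iteFn_apply_true (show take1Fn (true :: cwE (c, s)) = [true] from rfl),
    iteFn_apply_false (by rw [Function.comp_apply, List.tail_cons, bgCondFn_apply, decide_eq_false h])]
  show true :: bgOutFn ((true :: cwE (c, s)).tail) = _
  rw [List.tail_cons, bgOutFn_apply]

/-! ### The orbit -/

/-- One more step. [folklore] -/
theorem iterLS_succ (c : IT × List Bool) (j : ℕ) : iterLS c (j + 1) = stepLS c (iterLS c j) := by
  rw [iterLS, Function.iterate_succ_apply']; rfl

/-- **The orbit of the round function**: rounds `j ≤ L 2^{⌈t/2⌉}` output `0⟨x, state after j steps⟩`.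
[folklore] -/
theorem out_roundFn (c : IT × List Bool) (j : ℕ) (hj : j ≤ numSamples c.1.2.2 * numTerms c.1) :
    TM2Until.out bgRoundFn (lcE c) j = false :: cwE (c, iterLS c j) := by
  induction j with
  | zero => rw [TM2Until.out_eq, TM2Until.fed_zero, bgRoundFn_false]; rfl
  | succ j ih =>
    rw [TM2Until.out_eq, TM2Until.fed_succ, ih (by omega), List.tail_cons, bgRoundFn_true_cont]
    · rw [iterLS_succ]
    · rw [iterLS_fst]
      exact Nat.div_lt_of_lt_mul (by rw [Nat.mul_comm]; omega)

/-- The last round raises the flag with the estimate. [folklore] -/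
theorem out_roundFn_final (c : IT × List Bool) :
    TM2Until.out bgRoundFn (lcE c) (numSamples c.1.2.2 * numTerms c.1 + 1) =
      true :: ratE (finalize (iterLS c (numSamples c.1.2.2 * numTerms c.1)).2.2.2.1
        (iterLS c (numSamples c.1.2.2 * numTerms c.1)).2.2.2.2 (denomT c.1) c.1.2.2) := by
  rw [TM2Until.out_eq, TM2Until.fed_succ, out_roundFn c _ le_rfl, List.tail_cons, bgRoundFn_true_halt]
  have hA : 0 < numTerms c.1 := Nat.one_le_two_pow
  rw [iterLS_fst, Nat.mul_div_cancel _ hA]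
  exact lt_irrefl _

/-- The fed words. [folklore] -/
theorem fed_roundFn_succ (c : IT × List Bool) (j : ℕ) (hj : j ≤ numSamples c.1.2.2 * numTerms c.1) :
    TM2Until.fed bgRoundFn (lcE c) (j + 1) = true :: cwE (c, iterLS c j) := by
  rw [TM2Until.fed_succ, out_roundFn c j hj, List.tail_cons]

/-! ### Lengths along the orbit -/

/-- The bound on the words of the orbit: `2|x| + 6 + 150 (L + K + 1)`. [folklore] -/
def wordBound (c : IT × List Bool) : ℕ :=
  2 * (lcE c).length + 6 + 150 * (numSamples c.1.2.2 + SymState.numV (finalT c.1).nv (finalT c.1) + 1)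

/-- Fed words are short. [folklore] -/
theorem length_fed_le (c : IT × List Bool) (j : ℕ) (hj : j ≤ numSamples c.1.2.2 * numTerms c.1 + 1) :
    (TM2Until.fed bgRoundFn (lcE c) j).length ≤ wordBound c := by
  unfold wordBound
  cases j with
  | zero => rw [TM2Until.fed_zero, List.length_cons]; omega
  | succ j =>
    rw [fed_roundFn_succ c j (by omega), List.length_cons]
    have := length_lsE_iterLS_le c (L := numSamples c.1.2.2) (j := j) (by omega)
    show (boolPair (lcE c) (lsE (iterLS c j))).length + 1 ≤ _
    rw [length_boolPair]; omega

/-! ### Polynomial bookkeeping -/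

/-- A polynomial is below a multiple of a power of `x + 1`. [folklore] -/
theorem exists_eval_le_mul_pow (Q : Polynomial ℕ) : ∃ c d : ℕ, ∀ x : ℕ, Q.eval x ≤ c * (x + 1) ^ d := by
  refine ⟨∑ i ∈ range (Q.natDegree + 1), Q.coeff i, Q.natDegree, fun x => ?_⟩
  rw [Polynomial.eval_eq_sum_range, Finset.sum_mul]
  refine Finset.sum_le_sum fun i hi => ?_
  have hi' : i ≤ Q.natDegree := Nat.lt_succ_iff.1 (Finset.mem_range.1 hi)
  exact Nat.mul_le_mul_left _ ((Nat.pow_le_pow_left (Nat.le_succ x) i).trans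
    (Nat.pow_le_pow_right (Nat.succ_pos x) hi'))

/-- The length of a gate code. [folklore] -/
theorem length_gcE_gateTriple_le {N : ℕ} (g : QGate cliffordT N) : (gcE (gateTriple g)).length ≤ 2 * N ^ 2 + 6 * N + 19 := by
  have hws : ∀ (k : ℕ) (e : Fin k ↪ Fin N), (listE natE (List.ofFn fun i => (e i : ℕ))).length ≤ 2 * k + 2 + k * (2 * N + 2) := by
    intro k e
    show (boolPair (unE _) (rawE natE _)).length ≤ _
    rw [length_boolPair, length_unE, List.length_ofFn]
    have := length_rawE_le_of_forall natE (List.ofFn fun i => (e i : ℕ)) N (fun a ha => by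
      rw [List.mem_ofFn] at ha
      obtain ⟨i, rfl⟩ := ha
      exact (length_natE_le _).trans (e i).2.le)
    rw [List.length_ofFn] at this
    omega
  rcases g with ⟨op, e⟩ | ⟨k, e⟩
  · have hc : (natE (Encodable.encode op)).length ≤ 3 := by
      refine (length_natE_le _).trans ?_
      cases op <;> decide
    have ha : cliffordT.arity op ≤ 2 := by cases op <;> decide
    have hk := hws _ e
    show (false :: boolPair (natE (Encodable.encode op)) (listE natE (List.ofFn fun i => (e i : ℕ)))).length ≤ _
    rw [List.length_cons, length_boolPair]
    have : cliffordT.arity op * (2 * N + 2) ≤ 2 * (2 * N + 2) := Nat.mul_le_mul_right _ ha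
    nlinarith
  · have hkN : k + 1 ≤ N := by simpa using Fintype.card_le_of_embedding e
    have hc : (natE k).length ≤ N := (length_natE_le _).trans (by omega)
    have hk := hws _ e
    show (true :: boolPair (natE k) (listE natE (List.ofFn fun i => (e i : ℕ)))).length ≤ _
    rw [List.length_cons, length_boolPair]
    have : (k + 1) * (2 * N + 2) ≤ N * (2 * N + 2) := Nat.mul_le_mul_right _ hkN
    nlinarith

/-- **The input length is cubic in the parameters**: `|encode i| ≤ 130 (n + m + |circ| + q + 2)³`.
[folklore] -/
theorem length_encode_le (i : CliffordTInstance) :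
    (CliffordTInstance.encode i).length ≤ 130 * (i.n + i.m + i.circ.size + i.q + 2) ^ 3 := by
  set S := i.n + i.m + i.circ.size + i.q + 2 with hS
  have hNS : i.n + i.m ≤ S := by omega
  have hgc : ∀ t ∈ i.circ.gates.map gateTriple, (gcE t).length ≤ 2 * S ^ 2 + 6 * S + 19 := by
    intro t ht
    rw [List.mem_map] at ht
    obtain ⟨g, _, rfl⟩ := ht
    refine (length_gcE_gateTriple_le g).trans ?_
    have := Nat.pow_le_pow_left hNS 2
    omega
  have hraw := length_rawE_le_of_forall gcE (i.circ.gates.map gateTriple) _ hgc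
  rw [List.length_map] at hraw
  have hsize : i.circ.gates.length ≤ S := by show i.circ.size ≤ S; omega
  rw [encode_eq_itE]
  show (boolPair (boolPair (natE i.n) (boolPair (unE i.m) (rawE gcE (i.circ.gates.map gateTriple))))
    (boolPair (strE (List.ofFn i.x)) (unE i.q))).length ≤ _
  rw [length_boolPair, length_boolPair, length_boolPair, length_boolPair, length_unE, length_unE]
  simp only [strE, id, List.length_ofFn]
  have hn := length_natE_le i.n
  have h1 : (rawE gcE (i.circ.gates.map gateTriple)).length ≤ S * (2 * (2 * S ^ 2 + 6 * S + 19) + 2) :=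
    hraw.trans (Nat.mul_le_mul_right _ hsize)
  have hS1 : 1 ≤ S := by omega
  have p1 : S ≤ S ^ 3 := by nlinarith
  have p2 : S ^ 2 ≤ S ^ 3 := Nat.pow_le_pow_right hS1 (by norm_num)
  have p3 : 1 ≤ S ^ 3 := Nat.one_le_pow _ _ hS1
  have e : S * (2 * (2 * S ^ 2 + 6 * S + 19) + 2) = 4 * S ^ 3 + 12 * S ^ 2 + 40 * S := by ring
  omega

/-! ### The machine -/

set_option maxHeartbeats 400000 in
/-- **The estimator runs in time `c (n + m + |circ| + q + 2)^k · 2^{⌈t/2⌉}`.**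
[cite: BravyiGosset2016, p. 2 eq. (2) and §II] -/
theorem randAlg_runsInTime : ∃ c k : ℕ, randAlg.RunsInTime CliffordTInstance.encode encodeRat (CliffordTInstance.timeBound c k) := by
  obtain ⟨pF, Mx, hMx⟩ := bgRoundFn_mem_FP
  set B := TM2Comp.machinePushBound Mx.tm with hB
  -- the word bound and the round cost as polynomials in `ℓ = |encode i|`
  let Xl : Polynomial ℕ := 2 * X + 2 + 16 * (X + 1) ^ 2 * (X ^ 2 + 2 * X)
  let Lp : Polynomial ℕ := 16 * (X + 1) ^ 2
  let Wp : Polynomial ℕ := 2 * Xl + 6 + 150 * (Lp + (160 * (X + 1) ^ 3 + 1) + 1)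
  let Rp : Polynomial ℕ := pF.comp Wp + 2 * (Wp + C B * pF.comp Wp) + 1
  let Q : Polynomial ℕ := 2 * Xl + 3 + (Lp + 2) * Rp
  obtain ⟨c₀, d₀, hQ⟩ := exists_eval_le_mul_pow Q
  refine ⟨c₀ * 131 ^ d₀, 3 * d₀, TM2Until.untilAux Mx, fun i r hr => ?_⟩
  -- notation
  set ℓ := (CliffordTInstance.encode i).length with hℓ
  set it := instTuple i with hit
  set c : IT × List Bool := (it, r) with hc
  set L := numSamples i.q with hL
  set A := numTerms it with hA
  set K := SymState.numV (finalT it).nv (finalT it) with hK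
  have hx : boolPair (CliffordTInstance.encode i) r = lcE c := boolPair_encode_eq i r
  have hq : c.1.2.2 = i.q := rfl
  -- the orbit
  have hcont : ∀ j < L * A + 1, ∃ s, TM2Until.out bgRoundFn (lcE c) j = false :: s := fun j hj =>
    ⟨_, out_roundFn c j (show j ≤ L * A by omega)⟩
  have hhalt : TM2Until.out bgRoundFn (lcE c) (L * A + 1) = true :: encodeRat (randAlg.run i r) := by
    show _ = true :: encodeRat (estimate i r)
    rw [encodeRat_eq_ratE, estimate_eq_finalize_iterLS, ← hq]
    exact out_roundFn_final c
  have hrun := TM2Until.untilAux_outputsWithin Mx hMx (lcE c) (L * A + 1) _ hcont hhalt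
  rw [hx]
  refine hrun.mono ?_
  -- sizes: `ℓ`, `|x|`, `L`, `K`
  have hpar := params_le_length_encode i
  rw [← hℓ] at hpar
  have hxl : (lcE c).length = 2 * ℓ + 2 + coinLen ℓ := by
    rw [← hx, length_boolPair, hr]; rfl
  have hXl : Xl.eval ℓ = 2 * ℓ + 2 + coinLen ℓ := by
    simp only [Xl, eval_add, eval_mul, eval_pow, eval_X, eval_ofNat, eval_one, coinLen, numSamples, blockLen]; ring
  have hLp : Lp.eval ℓ = 16 * (ℓ + 1) ^ 2 := by simp [Lp]
  have hLle : L ≤ Lp.eval ℓ := by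
    rw [hLp, hL]; unfold numSamples; have : i.q ≤ ℓ := by omega
    exact Nat.mul_le_mul_left _ (Nat.pow_le_pow_left (by omega) 2)
  have hKle : K ≤ 160 * (ℓ + 1) ^ 3 + 1 := by
    have h1 := numV_le_stE (finalT it)
    have h2 := (shaped_finalT it).length_stE_le
    have h3 : nWires it + it.1.2.2.length + 1 ≤ ℓ + 1 := by
      show (List.ofFn i.x).length + i.m + (i.circ.gates.map gateTriple).length + 1 ≤ ℓ + 1
      rw [List.length_ofFn, List.length_map]
      have : i.circ.gates.length = i.circ.size := rfl
      omega
    have h4 := Nat.pow_le_pow_left h3 3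
    rw [hK]
    nlinarith
  have hW : wordBound c ≤ Wp.eval ℓ := by
    unfold wordBound
    simp only [Wp, eval_add, eval_mul, eval_ofNat, eval_one, eval_pow, eval_X]
    rw [hXl, ← hxl]
    have : numSamples c.1.2.2 = L := by rw [hq]
    rw [this, ← hK]
    simp only [Lp, eval_mul, eval_pow, eval_add, eval_X, eval_one, eval_ofNat] at hLle
    nlinarith [hLle, hKle]
  -- the cost of one round
  have hcost : ∀ j ∈ range (L * A + 1 + 1), TM2Until.roundCost bgRoundFn (fun u => pF.eval u.length) (lcE c) j ≤ Rp.eval ℓ := by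
    intro j hj
    have hj' : j ≤ L * A + 1 := Nat.lt_succ_iff.1 (Finset.mem_range.1 hj)
    unfold TM2Until.roundCost
    have hf : (TM2Until.fed bgRoundFn (lcE c) j).length ≤ Wp.eval ℓ :=
      (length_fed_le c j (show j ≤ L * A + 1 from hj')).trans hW
    have ho : (TM2Until.out bgRoundFn (lcE c) j).length ≤ Wp.eval ℓ + B * pF.eval (Wp.eval ℓ) := by
      rw [TM2Until.out_eq]
      refine (TM2Comp.length_le_of_outputsWithin Mx (hMx _)).trans ?_
      exact Nat.add_le_add hf (Nat.mul_le_mul_left _ (TM2Iter.eval_mono pF hf))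
    have hp : pF.eval (TM2Until.fed bgRoundFn (lcE c) j).length ≤ pF.eval (Wp.eval ℓ) := TM2Iter.eval_mono pF hf
    simp only [Rp, eval_add, eval_mul, eval_comp, eval_C, eval_ofNat, eval_one]
    omega
  have hsum := Finset.sum_le_sum hcost
  rw [Finset.sum_const, Finset.card_range, smul_eq_mul] at hsum
  -- the total
  have hA1 : 1 ≤ A := Nat.one_le_two_pow
  have htot : 2 * (lcE c).length + 3 + ∑ j ∈ range (L * A + 1 + 1),
      TM2Until.roundCost bgRoundFn (fun u => pF.eval u.length) (lcE c) j ≤ A * Q.eval ℓ := by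
    refine (Nat.add_le_add_left hsum _).trans ?_
    simp only [Q, eval_add, eval_mul, eval_ofNat]
    rw [hXl, ← hxl]
    have e1 : L * A + 1 + 1 ≤ (Lp.eval ℓ + 2) * A := by nlinarith
    have e2 : (L * A + 1 + 1) * Rp.eval ℓ ≤ A * ((Lp.eval ℓ + 2) * Rp.eval ℓ) := by
      calc (L * A + 1 + 1) * Rp.eval ℓ ≤ (Lp.eval ℓ + 2) * A * Rp.eval ℓ := Nat.mul_le_mul_right _ e1
        _ = A * ((Lp.eval ℓ + 2) * Rp.eval ℓ) := by ring
    nlinarith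
  refine htot.trans ?_
  -- `A · Q(ℓ) ≤ c (S)^k · A`
  unfold CliffordTInstance.timeBound
  rw [← numA_finalT i, ← hit]
  change A * Q.eval ℓ ≤ c₀ * 131 ^ d₀ * (i.n + i.m + i.circ.size + i.q + 2) ^ (3 * d₀) * A
  set S := i.n + i.m + i.circ.size + i.q + 2 with hS
  have hℓS : ℓ + 1 ≤ 131 * S ^ 3 := by
    have := length_encode_le i
    rw [← hℓ, ← hS] at this
    have : 1 ≤ S ^ 3 := Nat.one_le_pow _ _ (by omega)
    omega
  have hQ' : Q.eval ℓ ≤ c₀ * 131 ^ d₀ * S ^ (3 * d₀) := by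
    refine (hQ ℓ).trans ?_
    rw [Nat.mul_assoc]
    refine Nat.mul_le_mul_left _ ?_
    calc (ℓ + 1) ^ d₀ ≤ (131 * S ^ 3) ^ d₀ := Nat.pow_le_pow_left hℓS _
      _ = 131 ^ d₀ * S ^ (3 * d₀) := by rw [mul_pow, ← pow_mul]
  calc A * Q.eval ℓ ≤ A * (c₀ * 131 ^ d₀ * S ^ (3 * d₀)) := Nat.mul_le_mul_left _ hQ'
    _ = c₀ * 131 ^ d₀ * S ^ (3 * d₀) * A := by ring

end Literature.Computability.QuantumComplexity.BravyiGosset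

namespace Literature.Computability.QuantumComplexity

/-- **Discharge of `BravyiGosset2016_estimateAcceptProb`** (Bravyi–Gosset 2016, p. 2 eq. (2) with
`w = 1`, `β = 1/2`, `p_f = 1/4`): the randomized algorithm `BravyiGosset.randAlg` — symbolic
Clifford tracking, the `χ ≤ 2^{⌈t/2⌉}`-term decomposition of `T^{⊗t}` into pairs, norm
estimation with `L = 16 (q+1)²` random equatorial test states evaluated by exact Gauss sums over
`ℤ[i]`, and a dyadic output — runs in time `c (n + m + |circ| + q + 2)^k 2^{⌈t/2⌉}` on every
instance and, on oracle-free instances, outputs a rational within relative error `1/(q+1)` of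
the acceptance probability with probability at least `3/4`.
[cite: BravyiGosset2016, p. 2 eq. (2) and §II eq. (9)–(17)] -/
theorem BravyiGosset2016_estimateAcceptProb_holds : BravyiGosset2016_estimateAcceptProb := by
  obtain ⟨c, k, h⟩ := BravyiGosset.randAlg_runsInTime
  exact ⟨BravyiGosset.randAlg, c, k, h, BravyiGosset.pr_goodEstimates_ge⟩

end Literature.Computability.QuantumComplexity
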